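import Mathlib
import Summits.Ventures.PercRepro2.Defs
import Summits.Ventures.PercRepro2.Graph
import Summits.Ventures.PercRepro2.OneColourSwitch
import Summits.Ventures.PercRepro2.RegionHubSign
import Summits.Ventures.PercRepro2.SideSwitch
import Summits.Ventures.PercRepro2.SideSwitchM9
import Summits.Ventures.PercRepro2.M9CornerHarris

/-!
# Harris on ONE corner of the hypercube (blind cell PercRepro2, p3 g33, 2026-08-28;
`proofs/P3-BSTAR.md` §3, §7)

The lane's Harris step bounds `Σ_T D·S` over the whole hypercube `2^A` (`D` increasing with
total `0`, `S` decreasing; `sum_mul_nonpos_of_monotone_antitone`) and over a corner PAIR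
(`sum_corners_mul_nonpos`, M9CornerHarris).  The one-sided `K`-points of a `DZero` fibre are a
SINGLE corner — the subsets `T` of switched blocks disjoint from the block of `d` — and on that
corner the totals of `D` and `S` are no longer `0`.  Proved here: when `D` and `S` are ODD under
the complement `T ↦ A ∖ T` (as the fibre functions `G(T) − G(A ∖ T)` and `σ_rs(ρ_T)` are), the
lower corner `2^{A ∖ F}` has `Σ D ≤ 0` (`sum_lower_corner_nonpos_of_mono_odd`: reindex by the
complement within `A ∖ F`, then `D (T ∪ F) ≥ D T`), `Σ S ≥ 0`, and Harris on the sub-cube gives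
**`Σ_{T ⊆ A ∖ F} D T · S T ≤ 0`** (`sum_lower_corner_mul_nonpos`); the upper corner `{F ⊆ T}`
has the SAME sum (`sum_upper_corner_eq_lower`, the complement bijection), so it is `≤ 0` too
(`sum_upper_corner_mul_nonpos`) and the corner pair sums to twice the lower corner
(`sum_corners_eq_two_mul_lower`).  Own work; std axioms.
-/

namespace Summit.Ventures.PercRepro2

namespace SideSwitch

open Finset

variable {α : Type*} [DecidableEq α]

/-- A subset of `A \ F` is a subset of `A`. -/
lemma subset_of_subset_sdiff {A F T : Finset α} (hT : T ⊆ A \ F) : T ⊆ A :=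
  fun _ hx => (Finset.mem_sdiff.1 (hT hx)).1

/-- A subset of `A \ F` together with `F ⊆ A` is a subset of `A`. -/
lemma union_subset_of_subset_sdiff {A F T : Finset α} (hFA : F ⊆ A) (hT : T ⊆ A \ F) :
    T ∪ F ⊆ A :=
  Finset.union_subset (subset_of_subset_sdiff hT) hFA

/-- The complement within `A \ F` is the complement in `A` of `T ∪ F`. -/
lemma sdiff_sdiff_eq_sdiff_union (A F T : Finset α) : (A \ F) \ T = A \ (T ∪ F) := by
  ext x
  simp only [Finset.mem_sdiff, Finset.mem_union]
  tauto

/-- **The lower corner of an increasing odd function has non-positive sum**: for `D` increasing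
on `2^A` with `D (A \ T) = -D T`, `Σ_{T ⊆ A \ F} D T ≤ 0`. -/
lemma sum_lower_corner_nonpos_of_mono_odd (A F : Finset α) (hFA : F ⊆ A) (D : Finset α → ℤ)
    (hD : ∀ T T', T ⊆ T' → T' ⊆ A → D T ≤ D T') (hodd : ∀ T ⊆ A, D (A \ T) = - D T) :
    ∑ T ∈ (A \ F).powerset, D T ≤ 0 := by
  have h1 : ∑ T ∈ (A \ F).powerset, D T = ∑ T ∈ (A \ F).powerset, D ((A \ F) \ T) :=
    (sum_powerset_sdiff (A \ F) D).symm
  have h2 : ∀ T ∈ (A \ F).powerset, D ((A \ F) \ T) = - D (T ∪ F) := by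
    intro T hT
    rw [sdiff_sdiff_eq_sdiff_union,
      hodd (T ∪ F) (union_subset_of_subset_sdiff hFA (Finset.mem_powerset.1 hT))]
  have h3 : ∀ T ∈ (A \ F).powerset, D T ≤ D (T ∪ F) := fun T hT =>
    hD T (T ∪ F) Finset.subset_union_left
      (union_subset_of_subset_sdiff hFA (Finset.mem_powerset.1 hT))
  have h4 : ∑ T ∈ (A \ F).powerset, D T = - ∑ T ∈ (A \ F).powerset, D (T ∪ F) := by
    rw [h1, ← Finset.sum_neg_distrib]
    exact Finset.sum_congr rfl h2
  have h5 : ∑ T ∈ (A \ F).powerset, D T ≤ ∑ T ∈ (A \ F).powerset, D (T ∪ F) :=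
    Finset.sum_le_sum h3
  linarith

/-- **The lower corner of a decreasing odd function has non-negative sum.** -/
lemma sum_lower_corner_nonneg_of_anti_odd (A F : Finset α) (hFA : F ⊆ A) (S : Finset α → ℤ)
    (hS : ∀ T T', T ⊆ T' → T' ⊆ A → S T' ≤ S T) (hodd : ∀ T ⊆ A, S (A \ T) = - S T) :
    0 ≤ ∑ T ∈ (A \ F).powerset, S T := by
  have := sum_lower_corner_nonpos_of_mono_odd A F hFA (fun T => - S T)
    (fun T T' h1 h2 => by have := hS T T' h1 h2; linarith)
    (fun T hT => by rw [hodd T hT])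
  simp only [Finset.sum_neg_distrib] at this
  linarith

/-- **Harris on the lower corner**: `D` increasing and odd, `S` decreasing and odd on `2^A`
⟹ `Σ_{T ⊆ A \ F} D T · S T ≤ 0`. -/
theorem sum_lower_corner_mul_nonpos (A F : Finset α) (hFA : F ⊆ A) (D S : Finset α → ℤ)
    (hD : ∀ T T', T ⊆ T' → T' ⊆ A → D T ≤ D T') (hS : ∀ T T', T ⊆ T' → T' ⊆ A → S T' ≤ S T)
    (hDodd : ∀ T ⊆ A, D (A \ T) = - D T) (hSodd : ∀ T ⊆ A, S (A \ T) = - S T) :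
    ∑ T ∈ (A \ F).powerset, D T * S T ≤ 0 := by
  have hD0 := sum_lower_corner_nonpos_of_mono_odd A F hFA D hD hDodd
  have hS0 := sum_lower_corner_nonneg_of_anti_odd A F hFA S hS hSodd
  have hH := harris_powerset (A \ F) D (fun T => - S T)
    (fun T T' h1 h2 => hD T T' h1 (subset_of_subset_sdiff h2))
    (fun T T' h1 h2 => by have := hS T T' h1 (subset_of_subset_sdiff h2); linarith)
  simp only [Finset.sum_neg_distrib, mul_neg] at hH
  have hN : (0 : ℤ) < 2 ^ (A \ F).card := pow_pos two_pos _
  have hprod : (∑ T ∈ (A \ F).powerset, D T) * (∑ T ∈ (A \ F).powerset, S T) ≤ 0 :=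
    mul_nonpos_of_nonpos_of_nonneg hD0 hS0
  by_contra hcon
  have hpos : 0 < ∑ T ∈ (A \ F).powerset, D T * S T := lt_of_not_ge hcon
  have := mul_pos hN hpos
  nlinarith

/-- **The upper corner has the same sum as the lower corner** for a function `h` with
`h (A \ T) = h T`: `Σ_{T ⊆ A \ F} h (T ∪ F) = Σ_{T ⊆ A \ F} h T`. -/
lemma sum_upper_corner_eq_lower (A F : Finset α) (hFA : F ⊆ A) (h : Finset α → ℤ)
    (hsym : ∀ T ⊆ A, h (A \ T) = h T) :
    ∑ T ∈ (A \ F).powerset, h (T ∪ F) = ∑ T ∈ (A \ F).powerset, h T := by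
  rw [← sum_powerset_sdiff (A \ F) (fun T => h (T ∪ F))]
  refine Finset.sum_congr rfl (fun T hT => ?_)
  have hT' := Finset.mem_powerset.1 hT
  -- `((A \ F) \ T) ∪ F = A \ T`
  have hunion : ((A \ F) \ T) ∪ F = A \ T := by
    ext x
    simp only [Finset.mem_union, Finset.mem_sdiff]
    constructor
    · rintro (⟨⟨hxA, _⟩, hxT⟩ | hxF)
      · exact ⟨hxA, hxT⟩
      · exact ⟨hFA hxF, fun hxT => (Finset.mem_sdiff.1 (hT' hxT)).2 hxF⟩
    · rintro ⟨hxA, hxT⟩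
      by_cases hxF : x ∈ F
      · exact Or.inr hxF
      · exact Or.inl ⟨⟨hxA, hxF⟩, hxT⟩
  rw [hunion, hsym T (subset_of_subset_sdiff hT')]

/-- **Harris on the upper corner**: with `D`, `S` as in `sum_lower_corner_mul_nonpos`,
`Σ_{T ⊆ A \ F} D (T ∪ F) · S (T ∪ F) ≤ 0`. -/
theorem sum_upper_corner_mul_nonpos (A F : Finset α) (hFA : F ⊆ A) (D S : Finset α → ℤ)
    (hD : ∀ T T', T ⊆ T' → T' ⊆ A → D T ≤ D T') (hS : ∀ T T', T ⊆ T' → T' ⊆ A → S T' ≤ S T)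
    (hDodd : ∀ T ⊆ A, D (A \ T) = - D T) (hSodd : ∀ T ⊆ A, S (A \ T) = - S T) :
    ∑ T ∈ (A \ F).powerset, D (T ∪ F) * S (T ∪ F) ≤ 0 := by
  have hsym : ∀ T ⊆ A, D (A \ T) * S (A \ T) = D T * S T := by
    intro T hT
    rw [hDodd T hT, hSodd T hT]
    ring
  rw [sum_upper_corner_eq_lower A F hFA (fun T => D T * S T) hsym]
  exact sum_lower_corner_mul_nonpos A F hFA D S hD hS hDodd hSodd

/-- **The corner pair is twice the lower corner** for a complement-symmetric `h`. -/
lemma sum_corners_eq_two_mul_lower (A F : Finset α) (hFA : F ⊆ A) (hF : F.Nonempty)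
    (h : Finset α → ℤ) (hsym : ∀ T ⊆ A, h (A \ T) = h T) :
    ∑ T ∈ corners A F, h T = 2 * ∑ T ∈ (A \ F).powerset, h T := by
  rw [sum_corners_eq A F hFA hF h, Finset.sum_add_distrib, sum_upper_corner_eq_lower A F hFA h hsym]
  ring

end SideSwitch

end Summit.Ventures.PercRepro2
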